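import Literature.IUT.LogThetaLattice.HolomorphicLogShellVolume
import Literature.IUT.LogThetaLattice.PacketLogVolumes
import Literature.IUT.LogVolume.LogRadius
import HarnessLib

/-!
# The holomorphic log-shell at small ramification: `log_p(𝒪_K^×) = 𝔪_K`, `ℐ_K = 𝒪_K` (unramified), `m = 0`

Mochizuki, *Topics in absolute anabelian geometry III* [MochizukiAbsTopIII2015], Def 5.4 (iii), last
sentence (manuscript p. 126: "if `k` is absolutely unramified and `p_k` is odd, then `𝒪 = ℐ`"; Rmk 5.4.2
p. 129), and *Inter-universal Teichmüller Theory III*, Rmk 3.9.7 (i) p. 145 ("for all but finitely many of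
the … `w_ℚ ∈ 𝕍_ℚ^{non}` for which `p_{w_ℚ}` is unramified in `K`, … `𝒪(−) = 𝓘((−))` … has zero log-volume";
claim key `Mochizuki2012`, D-0012, status disputed) together with [IUTchIV] Prop 1.2 (i), equality clause
(p. 10: "the `⊆`'s are equalities when `p > 2` and `e_i ≤ p − 2`").

Third PROOF-ONLY companion (no definitions) of abc-iut-L6-d2's log-shell files, at the standard model
`L = PadicLogOnUnits.ofUnitLog p K` of abc-iut-S1's real `p`-adic logarithm, for `p > 2` and absolute
ramification index `e ≤ p − 2` (in particular for `K/ℚ_p` unramified, `p` odd):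
* `logUnits_eq_closedBall_of_absRamificationIdx_le`: `log_p(𝒪_K^×) = 𝔪_K` (abc-iut-S1 `prop12iEq_holds`,
  read on the closed ball of radius `‖ϖ‖ = p^{-1/e}`), hence `μ_K^log(log_p(𝒪_K^×)) = −f·log p`;
* **`torsionPExp_eq_zero_of_absRamificationIdx_le`**: `m = 0`, i.e. `K` contains NO nontrivial `p`-power
  root of unity and `#R^μ = p^f − 1` (`card_torsionUnits_of_absRamificationIdx_le`) — obtained by comparing
  the two kernel-checked values of `μ_K^log(log_p(𝒪_K^×))`: `−(f + m)·log p` ([IUTchIV] Prop 1.4 (ii) count,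
  abc-iut-S8/S1, `localLogVolume_logUnits_eq`) and `−f·log p` (the classical statement is that `ℚ_p(ζ_p)`
  has ramification index `p − 1 > e`);
* **AbsTopIII:Def5.4(iii)** last sentence at the model: `logShell_ofUnitLog_eq_closedBall_of_unramified`
  (`ℐ_K = 𝒪_K` for `e = 1`, `p` odd — abc-iut-L4-t3's conditional `logShell_eq_closedBall_of` with its
  hypothesis discharged), hence `μ_K(ℐ_K) = 1`, `μ_K^log(ℐ_K) = 0` — the `hshell` input of abc-iut-L6-t4's
  **IUTchIII:Rmk3.9.7(i)** `Remark397i_shellFamily_isGlobal` at every unramified odd place;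
* `localLogVolume_logShell_ofUnitLog_of_absRamificationIdx_le`: `μ_K^log(ℐ_K) = f·(e − 1)·log p` in the
  whole range `e ≤ p − 2`;
* **IUTchIII:Rmk3.9.1(i)** at the model: abc-iut-L6-t4's `packetLogVolume` of the shell region
  `Π_i ℐ_{k_i}` (normalised Haar measures, shells of the real logarithms) "computed entirely in terms of the
  given initial Θ-data" — `packetLogVolume_logShell_ofUnitLog` (`= Σ_i w_i·(f_i e_i c − f_i − m_i)·log p`).

Classical local-field facts; nothing here bears on the disputed [IUTchIII] Cor 3.12 or takes a side.
-/

noncomputable section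

namespace Literature.IUT.LogThetaLattice

open Set Metric MeasureTheory
open scoped Pointwise NNReal ENNReal
open Literature.AnabelianGeometry.AbsoluteAnabelian
open Literature.IUT.LogVolume (unitLog absRamificationIdx residueDegree torsionUnits torsionPExp
  card_torsionUnits absRamificationIdx_pos norm_prime_eq_norm_pow norm_eq_rpow_of_isUniformizer
  prop12iEq_holds pBall_eq_closedBall logRadiusB_eq)
open Literature.NumberTheory.GaloisRepresentations.Ultrametric

variable (p : ℕ) [Fact p.Prime]
variable (K : Type*) [NontriviallyNormedField K] [instK : NormedAlgebra ℚ_[p] K] [IsUltrametricDist K]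
  [ProperSpace K]

/-! ### `log_p(𝒪_K^×) = 𝔪_K` for `p > 2`, `e ≤ p − 2` -/

/-- **[IUTchIV] Prop 1.2 (i), equality clause, on the unit ball of `𝔪_K`**: for `p > 2` and `e ≤ p − 2`,
`log_p(𝒪_K^×) = 𝔪_K = closedBall 0 ‖ϖ‖` for every norm uniformizer `ϖ` (abc-iut-S1 `prop12iEq_holds`:
`log_p(R^×) = p^{−b}·R` with `b = −1/e`, and `‖ϖ‖ = p^{−1/e}`). [claim: Mochizuki2012, status: disputed] -/
theorem logUnits_eq_closedBall_of_absRamificationIdx_le (hp : 2 < p)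
    (he : absRamificationIdx p K ≤ p - 2) {ϖ : Kˣ} (hϖ : IsUniformizer ϖ) :
    LogVolume.logUnits K = closedBall (0 : K) ‖(ϖ : K)‖ := by
  rw [(prop12iEq_holds p K hp he).2, pBall_eq_closedBall, logRadiusB_eq hp (absRamificationIdx_pos p K) he,
    neg_neg, norm_eq_rpow_of_isUniformizer p K hϖ]

/-- Hence `μ_K^log(log_p(𝒪_K^×)) = μ_K^log(𝔪_K) = −f·log p` for `p > 2`, `e ≤ p − 2` ([AbsTopIII] Prop 5.7 (i)(a):
`μ_K(𝔪_K) = p^{−f}`, abc-iut-S2 `localVolume_real_closedBall_zpow`). [claim: Mochizuki2012, status: disputed] -/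
theorem localLogVolume_logUnits_of_absRamificationIdx_le [MeasurableSpace K] [BorelSpace K] (hp : 2 < p)
    (he : absRamificationIdx p K ≤ p - 2) :
    localLogVolume K (LogVolume.logUnits K) = -(residueDegree p K * Real.log p) := by
  obtain ⟨ϖ, hϖ⟩ := exists_isUniformizer (F := K)
  rw [localLogVolume, localVolume_eq_toReal, logUnits_eq_closedBall_of_absRamificationIdx_le p K hp he hϖ,
    ← zpow_one ‖(ϖ : K)‖, LogVolume.localVolume_real_closedBall_zpow K hϖ 1, residueCard_eq_pow p K,
    Real.log_zpow, Nat.cast_pow, Real.log_pow]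
  push_cast
  ring

/-! ### No `p`-power roots of unity below the ramification of `ℚ_p(ζ_p)` -/

/-- **`m = 0` for `p > 2`, `e ≤ p − 2`**: the `p`-power torsion exponent `torsionPExp p K` of `K^×` vanishes,
i.e. `K` contains no nontrivial `p`-power root of unity (classically: `ℚ_p(ζ_p)/ℚ_p` is totally ramified of
degree `p − 1 > e`). PROVED by comparing two kernel-checked values of the same volume:
`μ_K^log(log_p(𝒪_K^×)) = −(f + m)·log p` ([IUTchIV] Prop 1.4 (ii) count, `localLogVolume_logUnits_eq`) and
`= −f·log p` (`log_p(𝒪_K^×) = 𝔪_K`). [cite: NeukirchANT1999, Ch. II Prop. 7.13] -/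
theorem torsionPExp_eq_zero_of_absRamificationIdx_le (hp : 2 < p) (he : absRamificationIdx p K ≤ p - 2) :
    torsionPExp p K = 0 := by
  borelize K
  have h1 := localLogVolume_logUnits_eq p K
  rw [localLogVolume_logUnits_of_absRamificationIdx_le p K hp he] at h1
  have hlog : Real.log p ≠ 0 :=
    (Real.log_pos (by exact_mod_cast (Fact.out : p.Prime).one_lt : (1 : ℝ) < p)).ne'
  have h2 : (residueDegree p K : ℝ) = ((residueDegree p K + torsionPExp p K : ℕ) : ℝ) :=
    mul_right_cancel₀ hlog (neg_injective h1)
  push_cast at h2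
  have h3 : (torsionPExp p K : ℝ) = 0 := by linarith
  exact_mod_cast h3

/-- **`#R^μ = p^f − 1` for `p > 2`, `e ≤ p − 2`**: the roots of unity of `K` are exactly the `(q − 1)`-st
roots of unity (abc-iut-S1 `card_torsionUnits` with `m = 0`). [cite: NeukirchANT1999, Ch. II Prop. 7.13] -/
theorem card_torsionUnits_of_absRamificationIdx_le (hp : 2 < p) (he : absRamificationIdx p K ≤ p - 2) :
    Nat.card (torsionUnits K) = p ^ residueDegree p K - 1 := by
  rw [card_torsionUnits p K, torsionPExp_eq_zero_of_absRamificationIdx_le p K hp he, pow_zero, one_mul]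

/-! ### The log-shell: `μ_K^log(ℐ_K) = f·(e − 1)·log p`; `ℐ_K = 𝒪_K` when `e = 1` -/

/-- **IUTchIII:Prop1.2(vi)** (kurims p.32) at small ramification: for `p > 2`, `e ≤ p − 2`,
`μ_K^log(ℐ_K) = f·(e − 1)·log p` (`ℐ_K = p⁻¹·𝔪_K = 𝔪_K^{1−e}`). [claim: Mochizuki2012, status: disputed] -/
theorem localLogVolume_logShell_ofUnitLog_of_absRamificationIdx_le [MeasurableSpace K] [BorelSpace K]
    (hp : 2 < p) (he : absRamificationIdx p K ≤ p - 2) :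
    localLogVolume K (logShell (PadicLogOnUnits.ofUnitLog p K)) =
      residueDegree p K * ((absRamificationIdx p K : ℝ) - 1) * Real.log p := by
  have hp2 : p ≠ 2 := by omega
  rw [localLogVolume_logShell_ofUnitLog p K, localLogVolume_logUnits_of_absRamificationIdx_le p K hp he,
    if_neg hp2]
  push_cast
  ring

/-- **AbsTopIII:Def5.4(iii)**, last sentence (p. 126; Rmk 5.4.2) AT THE STANDARD MODEL: "if `k` is
absolutely unramified and `p_k` is odd, then `𝒪 = ℐ`" — abc-iut-L4-t3's conditional
`logShell_eq_closedBall_of` with its hypothesis `log_k(𝒪_k^×) = p*·𝒪_k` DISCHARGED for the real logarithm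
(`p* = p`, `log_p(𝒪_K^×) = 𝔪_K = p·𝒪_K` when `e = 1`). [cite: MochizukiAbsTopIII2015, Def 5.4 (iii) p. 126] -/
theorem logShell_ofUnitLog_eq_closedBall_of_unramified (hp : p ≠ 2) (he : absRamificationIdx p K = 1) :
    logShell (PadicLogOnUnits.ofUnitLog p K) = closedBall (0 : K) 1 := by
  have hp2 : 2 < p := lt_of_le_of_ne (Fact.out : p.Prime).two_le (Ne.symm hp)
  obtain ⟨ϖ, hϖ⟩ := exists_isUniformizer (F := K)
  refine logShell_eq_closedBall_of _ ?_
  rw [preLogShell_ofUnitLog, logUnits_eq_closedBall_of_absRamificationIdx_le p K hp2 (by omega) hϖ,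
    PadicLogOnUnits.ofUnitLog_pstar_of_ne_two p K hp, norm_prime_eq_norm_pow p K hϖ, he, pow_one]

/-- **AbsTopIII:Def5.4(iii)** last sentence, volume form: `μ_K(ℐ_K) = 1` for `K/ℚ_p` unramified, `p` odd.
[cite: MochizukiAbsTopIII2015, Def 5.4 (iii) p. 126] -/
theorem localVolume_logShell_ofUnitLog_of_unramified [MeasurableSpace K] [BorelSpace K] (hp : p ≠ 2)
    (he : absRamificationIdx p K = 1) : localVolume K (logShell (PadicLogOnUnits.ofUnitLog p K)) = 1 := by
  rw [logShell_ofUnitLog_eq_closedBall_of_unramified p K hp he, localVolume_closedBall_one]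

/-- **IUTchIII:Rmk3.9.7(i)** (kurims p.145) the `hshell` input of abc-iut-L6-t4's
`Remark397i_shellFamily_isGlobal`, AT THE STANDARD MODEL: at a place where `p` is odd and unramified in `K`,
the log-shell "`𝒪(−) = 𝓘((−))` … has zero log-volume": `μ_K^log(ℐ_K) = 0`.
[claim: Mochizuki2012, status: disputed] -/
theorem localLogVolume_logShell_ofUnitLog_of_unramified [MeasurableSpace K] [BorelSpace K] (hp : p ≠ 2)
    (he : absRamificationIdx p K = 1) : localLogVolume K (logShell (PadicLogOnUnits.ofUnitLog p K)) = 0 := by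
  rw [localLogVolume, localVolume_logShell_ofUnitLog_of_unramified p K hp he, Real.log_one]

/-- … and then `K` has no nontrivial `p`-power roots of unity: `torsionPExp p K = 0` for `K/ℚ_p` unramified,
`p` odd. [cite: NeukirchANT1999, Ch. II Prop. 7.13] -/
theorem torsionPExp_eq_zero_of_unramified (hp : p ≠ 2) (he : absRamificationIdx p K = 1) :
    torsionPExp p K = 0 :=
  torsionPExp_eq_zero_of_absRamificationIdx_le p K
    (lt_of_le_of_ne (Fact.out : p.Prime).two_le (Ne.symm hp)) (by have := (Fact.out : p.Prime).two_le; omega)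

/-! ### [IUTchIII] Rmk 3.9.1 (i): packet log-volumes of log-shells in terms of `(p, f_i, e_i, m_i)` -/

/-- **IUTchIII:Rmk3.9.1(i)** (kurims p.118) "by applying the formula of the final display of [AbsTopIII],
Proposition 5.8, (iii), for the log-volume of `𝓘_i`, one may compute the log-volumes
`μ^log_{α,v_ℚ}(𝓘(^α𝓕_{v_ℚ}))`, `μ^log_{A,v_ℚ}(𝓘(^A𝓕_{v_ℚ}))` entirely in terms of the given initial Θ-data" —
AT THE STANDARD MODEL: abc-iut-L6-t4's `packetLogVolume` (`PacketLogVolumes.lean`, whose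
`Remark391i_computable` takes the summand values `c_i` as input) of the direct product of the log-shells
`ℐ_{k_i}` of the real logarithms, for the normalised Haar measures of the summands, equals
`Σ_i w_i·(f_i·e_i·c − f_i − m_i)·log p` with `f_i, e_i, m_i` the residue degree, absolute ramification
index and `p`-power torsion exponent of `k_i` (`c = 2` iff `p = 2`). [claim: Mochizuki2012, status: disputed] -/
theorem packetLogVolume_logShell_ofUnitLog {ι : Type*} [Fintype ι] (k : ι → Type*)
    [∀ i, NontriviallyNormedField (k i)] [∀ i, NormedAlgebra ℚ_[p] (k i)] [∀ i, IsUltrametricDist (k i)]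
    [∀ i, ProperSpace (k i)] [∀ i, MeasurableSpace (k i)] [∀ i, BorelSpace (k i)] (w : ι → ℝ) :
    packetLogVolume w (fun i => localHaar (k i)) (fun i => logShell (PadicLogOnUnits.ofUnitLog p (k i))) =
      ∑ i, w i * ((((residueDegree p (k i) * (absRamificationIdx p (k i) * (if p = 2 then 2 else 1)) : ℕ) : ℝ) -
        ((residueDegree p (k i) + torsionPExp p (k i) : ℕ) : ℝ)) * Real.log p) :=
  Remark391i_computable w _ _ _ fun i => localLogVolume_logShell_ofUnitLog_eq p (k i)

end Literature.IUT.LogThetaLattice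

end
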